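import Literature.Barriers.AtomisticToContinuum.NoBVEstimatesMultiDUniformBound
import Literature.Analysis.PDE.MollifierRate
import HarnessLib

/-!
# The regularised quasilinear flows are Cauchy in `L²` as `δ → 0`

Brick B-ε, §1, of the Kato existence programme for the symmetrizable branch of Rauch's Local
Existence Theorem (towards `Rauch1986_smallAmplitudeExpansionL2`). For two regularisation
parameters `δ₁, δ₂ ∈ (0, 1]` let `U₁, U₂ : ℝ → L²` solve `Uᵢ' = F_{δᵢ}(Uᵢ)` from the same datum
`u₀`, and let `Wᵢ = ρ_{δᵢ} ⋆ Uᵢ` (smooth; `∂ₜWᵢ = -ρ_{δᵢ} ⋆ ρ_{δᵢ} ⋆ G(Wᵢ)` exactly). As long as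
the uniform `Hᵐ` bounds of `NoBVEstimatesMultiDUniformBound.lean` hold, the weighted `L²` energy
of the difference `dw = W₁ - W₂` obeys `|d/dt ⟪s(W₁)dw, dw⟫| ≤ A‖dw‖₂² + (δ₁+δ₂) B ‖dw‖₂`
[Majda1984, Ch. 2, Thm 2.1, proof, Step 2 (2.17)–(2.19)], [TaylorPDEIII2011, Ch. 16, §1,
(1.16)–(1.19)]: the mollification errors `ρ⋆ρ⋆G - G` are `O(δ)` in `L²` (tree:
`l2norm_normed_convolution_sub_self_le`), the top-order term `Σⱼ aⱼ(W₁)∂ⱼω` is symmetric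
hyperbolic with the same symmetrizer (one integration by parts), and the rest is Lipschitz.
Grönwall then gives `‖W₁(t) - W₂(t)‖₂ ≤ C (δ₁ + δ₂)` on `[-T, T]`:

* `smoothRep_regField_eq`, `hasDerivAt_weighted_pair` — the exact smooth equation of `Wᵢ` and
  the energy identity for an arbitrary `C¹` curve in `L²`;
* `l2norm_moll_moll_sub_self_le` — `‖ρ_δ⋆ρ_δ⋆h - h‖₂ ≤ 2δ Σⱼ‖∂ⱼh‖₂`;
* `abs_integral_top_le'`, `abs_integral_diff_le` — the static estimate of the pairing;
* `gronwall_two_sided` — `|Φ'| ≤ γΦ` on `[-T,T]` gives `Φ(t) ≤ e^{γ|t|}Φ(0)`;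
* `exists_cauchy_bound` — **the `L²`-Cauchy estimate**, uniform on `[-T, T]`.

Everything is proved; no named fact and no `sorry` is introduced.

## References

* [Majda1984] A. Majda, *Compressible Fluid Flow and Systems of Conservation Laws in Several
  Space Variables* (1984), Ch. 2, §2.1, Thm 2.1 (proof, Step 2).
* [TaylorPDEIII2011] M. E. Taylor, *Partial Differential Equations III*, 2nd ed. (2011), Ch. 16,
  §1, (1.16)–(1.19).
-/

noncomputable section

open MeasureTheory Set Function Filter Metric ContinuousLinearMap
open scoped ContDiff Topology ENNReal NNReal Convolution RealInnerProductSpace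

namespace Literature.Barriers.AtomisticToContinuum

open Literature.Analysis.PDE Literature.Analysis.FunctionSpaces Literature.Analysis.ODE

variable {d k : ℕ}

variable {M L : ℝ} {a : Fin d → EuclideanSpace ℝ (Fin k) → (EuclideanSpace ℝ (Fin k) →L[ℝ] EuclideanSpace ℝ (Fin k))}
  {b : EuclideanSpace ℝ (Fin k) → EuclideanSpace ℝ (Fin k)}
  {s : EuclideanSpace ℝ (Fin k) → (EuclideanSpace ℝ (Fin k) →L[ℝ] EuclideanSpace ℝ (Fin k))}
  {u₀ : EuclideanSpace ℝ (Fin d) → EuclideanSpace ℝ (Fin k)}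

/-! ### The exact equation of `W = ρ_δ ⋆ U` and the energy identity for a `C¹` curve -/

/-- **`ρ_δ ⋆ F_δ(V) = -ρ_δ ⋆ (ρ_δ ⋆ G(ρ_δ ⋆ V))`** as smooth functions (the representative of
`F_δ(V)` is `-ρ_δ ⋆ G` a.e., and convolution ignores null sets).
[cite: TaylorPDEIII2011, Ch. 16 §1, (1.9)] -/
theorem smoothRep_regField_eq (h : IsTameCoeff M L a b) {δ : ℝ} (hδ : 0 < δ)
    (V : Lp (EuclideanSpace ℝ (Fin k)) 2 (volume : Measure (EuclideanSpace ℝ (Fin d)))) :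
    smoothRep (moll (Fin d) hδ) (regField h hδ V) = fun x =>
      -(moll (Fin d) hδ ⋆[lsmul ℝ ℝ, volume] (moll (Fin d) hδ ⋆[lsmul ℝ ℝ, volume]
        gfield a b (smoothRep (moll (Fin d) hδ) V))) x := by
  set ρ := moll (Fin d) hδ with hρ
  set G := gfield a b (smoothRep ρ V) with hG
  have hGm : MemLp G 2 (volume : Measure (EuclideanSpace ℝ (Fin d))) := (memLp_gfield_smoothRep h hδ V).1
  have hae : ((regField h hδ V : Lp (EuclideanSpace ℝ (Fin k)) 2
      (volume : Measure (EuclideanSpace ℝ (Fin d)))) : EuclideanSpace ℝ (Fin d) → EuclideanSpace ℝ (Fin k))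
      =ᵐ[volume] fun y => -(ρ ⋆[lsmul ℝ ℝ, volume] G) y := by
    have h1 := Lp.coeFn_neg (mollL2 hδ (hGm.toLp G) : Lp (EuclideanSpace ℝ (Fin k)) 2
      (volume : Measure (EuclideanSpace ℝ (Fin d))))
    have h2 := coeFn_convL2 (continuous_moll hδ) (hasCompactSupport_moll hδ) (hGm.toLp G)
    rw [convolution_kernel_congr_ae (ρ := ρ) (MemLp.coeFn_toLp hGm)] at h2
    filter_upwards [h1, h2] with y hy1 hy2
    change ((-(mollL2 hδ (hGm.toLp G)) : Lp (EuclideanSpace ℝ (Fin k)) 2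
      (volume : Measure (EuclideanSpace ℝ (Fin d)))) : EuclideanSpace ℝ (Fin d) → EuclideanSpace ℝ (Fin k)) y = _
    rw [hy1, Pi.neg_apply]
    exact congrArg Neg.neg hy2
  have hneg : (fun y => -(ρ ⋆[lsmul ℝ ℝ, volume] G) y) = (-1 : ℝ) • (ρ ⋆[lsmul ℝ ℝ, volume] G) := by
    funext y; simp
  rw [smoothRep_def, convolution_kernel_congr_ae hae, hneg, convolution_smul]
  funext x
  simp

/-- **The energy identity for an arbitrary `C¹` curve** `Ω` in `L²`, weighted along the flow
`U`: `d/dt ⟪S(ρ_δ ⋆ U)Ω, Ω⟫ = ⟪S'Ω, Ω⟫ + 2⟪S Ω', Ω⟫`. [cite: Majda1984, Ch. 2 §2.1, (2.17)] -/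
theorem hasDerivAt_weighted_pair (hS : IsSymmSmoothCoeff M L a b s) {δ : ℝ} (hδ : 0 < δ)
    {U : ℝ → Lp (EuclideanSpace ℝ (Fin k)) 2 (volume : Measure (EuclideanSpace ℝ (Fin d)))}
    (hU : ∀ t, HasDerivAt U (regField hS.toIsTameCoeff hδ (U t)) t)
    {Ω : ℝ → Lp (EuclideanSpace ℝ (Fin k)) 2 (volume : Measure (EuclideanSpace ℝ (Fin d)))}
    {Ω' : Lp (EuclideanSpace ℝ (Fin k)) 2 (volume : Measure (EuclideanSpace ℝ (Fin d)))} {t : ℝ}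
    (hΩ : HasDerivAt Ω Ω' t) :
    HasDerivAt (fun τ => ⟪weightOp hS hδ (U τ) (Ω τ), Ω τ⟫)
      (⟪weightOpDeriv hS hδ (U t) (Ω t), Ω t⟫ + 2 * ⟪weightOp hS hδ (U t) Ω', Ω t⟫) t := by
  have hSW := hasDerivAt_weightOp hS hδ hU t
  have h1 := hSW.clm_apply hΩ
  have h2 := h1.inner ℝ hΩ
  refine h2.congr_deriv ?_
  rw [inner_add_left, inner_weightOp_comm hS hδ (U t) (Ω t) Ω', real_inner_comm (weightOp hS hδ (U t) Ω') (Ω t)]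
  ring

/-! ### The double mollification error -/

/-- **`‖ρ_δ ⋆ (ρ_δ ⋆ h) - h‖₂ ≤ 2δ Σⱼ ‖∂ⱼh‖₂`** for `h ∈ C¹` with `∂ⱼh ∈ L²` (the rate of
mollification, `l2norm_normed_convolution_sub_self_le`, applied to `h` and to `ρ_δ ⋆ h`).
[cite: Adams1975, Lemma 2.18] -/
theorem l2norm_moll_moll_sub_self_le {δ : ℝ} (hδ : 0 < δ)
    {h : EuclideanSpace ℝ (Fin d) → EuclideanSpace ℝ (Fin k)} (hh : ContDiff ℝ ∞ h)
    (hh2 : MemLp h 2 (volume : Measure (EuclideanSpace ℝ (Fin d))))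
    (hhj : ∀ j, MemLp (cwd [j] h) 2 (volume : Measure (EuclideanSpace ℝ (Fin d)))) :
    MemLp (fun x => (moll (Fin d) hδ ⋆[lsmul ℝ ℝ, volume] (moll (Fin d) hδ ⋆[lsmul ℝ ℝ, volume] h)) x
        - h x) 2 (volume : Measure (EuclideanSpace ℝ (Fin d))) ∧
      l2norm (fun x => (moll (Fin d) hδ ⋆[lsmul ℝ ℝ, volume] (moll (Fin d) hδ ⋆[lsmul ℝ ℝ, volume] h)) x
        - h x) ≤ 2 * δ * ∑ j, l2norm (cwd [j] h) := by
  set ρ := moll (Fin d) hδ with hρ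
  have hρh : ContDiff ℝ ∞ (ρ ⋆[lsmul ℝ ℝ, volume] h) :=
    contDiff_convolution_kernel (contDiff_moll hδ) (hasCompactSupport_moll hδ)
      (hh2.locallyIntegrable one_le_two)
  -- `∂ⱼ(ρ ⋆ h) = ρ ⋆ ∂ⱼh ∈ L²` with the same bound
  have hdj : ∀ j, cwd [j] (ρ ⋆[lsmul ℝ ℝ, volume] h) = ρ ⋆[lsmul ℝ ℝ, volume] cwd [j] h := fun j =>
    cwd_convolution_eq_convolution_cwd (continuous_moll hδ) (hasCompactSupport_moll hδ) hh [j]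
  have hmass : ∫ y, |ρ y| = 1 := by
    rw [show (fun y => |ρ y|) = ρ from funext fun y => abs_of_nonneg (moll_nonneg hδ y)]
    exact integral_moll hδ
  have hρhj : ∀ j, MemLp (cwd [j] (ρ ⋆[lsmul ℝ ℝ, volume] h)) 2 (volume : Measure (EuclideanSpace ℝ (Fin d)))
      ∧ l2norm (cwd [j] (ρ ⋆[lsmul ℝ ℝ, volume] h)) ≤ l2norm (cwd [j] h) := fun j => by
    rw [hdj j]
    obtain ⟨hm, hle⟩ := memLp_convolution_kernel (continuous_moll hδ) (hasCompactSupport_moll hδ) (hhj j)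
    rw [hmass, one_mul] at hle
    exact ⟨hm, hle⟩
  -- the two rate bounds
  obtain ⟨hm1, hle1⟩ := l2norm_normed_convolution_sub_self_le (bump (Fin d) hδ)
    (hh.of_le (by exact_mod_cast le_top)) (fun j => by simpa [cwd_singleton] using hhj j)
  obtain ⟨hm2, hle2⟩ := l2norm_normed_convolution_sub_self_le (bump (Fin d) hδ)
    (hρh.of_le (by exact_mod_cast le_top)) (fun j => by simpa [cwd_singleton] using (hρhj j).1)
  simp only [bump_rOut] at hle1 hle2
  change MemLp (fun x => (ρ ⋆[lsmul ℝ ℝ, volume] h) x - h x) 2 volume at hm1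
  change l2norm (fun x => (ρ ⋆[lsmul ℝ ℝ, volume] h) x - h x) ≤ _ at hle1
  change MemLp (fun x => (ρ ⋆[lsmul ℝ ℝ, volume] (ρ ⋆[lsmul ℝ ℝ, volume] h)) x
    - (ρ ⋆[lsmul ℝ ℝ, volume] h) x) 2 volume at hm2
  change l2norm (fun x => (ρ ⋆[lsmul ℝ ℝ, volume] (ρ ⋆[lsmul ℝ ℝ, volume] h)) x
    - (ρ ⋆[lsmul ℝ ℝ, volume] h) x) ≤ _ at hle2
  have hsum2 : ∑ j, l2norm (fun y => fderiv ℝ (ρ ⋆[lsmul ℝ ℝ, volume] h) y (bv j)) ≤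
      ∑ j, l2norm (cwd [j] h) :=
    Finset.sum_le_sum fun j _ => by simpa [cwd_singleton] using (hρhj j).2
  have heq : (fun x => (ρ ⋆[lsmul ℝ ℝ, volume] (ρ ⋆[lsmul ℝ ℝ, volume] h)) x - h x) =
      (fun x => (ρ ⋆[lsmul ℝ ℝ, volume] (ρ ⋆[lsmul ℝ ℝ, volume] h)) x - (ρ ⋆[lsmul ℝ ℝ, volume] h) x)
        + fun x => (ρ ⋆[lsmul ℝ ℝ, volume] h) x - h x := by
    funext x; simp
  rw [heq]
  refine ⟨hm2.add hm1, (l2norm_add_le hm2 hm1).trans ?_⟩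
  have hsum1 : ∑ j, l2norm (fun y => fderiv ℝ h y (bv j)) = ∑ j, l2norm (cwd [j] h) := rfl
  rw [hsum1] at hle1
  calc l2norm (fun x => (ρ ⋆[lsmul ℝ ℝ, volume] (ρ ⋆[lsmul ℝ ℝ, volume] h)) x - (ρ ⋆[lsmul ℝ ℝ, volume] h) x)
        + l2norm (fun x => (ρ ⋆[lsmul ℝ ℝ, volume] h) x - h x)
      ≤ δ * ∑ j, l2norm (cwd [j] h) + δ * ∑ j, l2norm (cwd [j] h) :=
        add_le_add (hle2.trans (mul_le_mul_of_nonneg_left hsum2 hδ.le)) hle1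
    _ = 2 * δ * ∑ j, l2norm (cwd [j] h) := by ring

/-! ### The static estimate of the pairing -/

/-- **The top-order term for an arbitrary field**: `|∫ ⟪aⱼ(w)∂ⱼf, s(w) f⟫| ≤ (M_P/2)‖f‖₂²` for a
smooth `f ∈ L²` with `∂ⱼf ∈ L²` (symmetry of `s aⱼ` and one integration by parts).
[cite: Majda1984, Ch. 2 §2.1, (2.18)] -/
theorem abs_integral_top_le' (hS : IsSymmSmoothCoeff M L a b s)
    {w : EuclideanSpace ℝ (Fin d) → EuclideanSpace ℝ (Fin k)} (hw : ContDiff ℝ ∞ w) {K₀ Cs1 Ca1 : ℝ}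
    (hK₀ : ∀ y, ‖s y‖ ≤ K₀) (j : Fin d)
    (hCs1 : ∀ x, ‖cwd [j] (fun y => s (w y)) x‖ ≤ Cs1)
    (hCa1 : ∀ x, ‖cwd [j] (fun y => a j (w y)) x‖ ≤ Ca1)
    {f : EuclideanSpace ℝ (Fin d) → EuclideanSpace ℝ (Fin k)} (hf : ContDiff ℝ ∞ f)
    (hf2 : MemLp f 2 (volume : Measure (EuclideanSpace ℝ (Fin d))))
    (hfj : MemLp (cwd [j] f) 2 (volume : Measure (EuclideanSpace ℝ (Fin d)))) :
    |∫ x, ⟪a j (w x) (cwd [j] f x), s (w x) (f x)⟫| ≤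
      (K₀ * M + (Cs1 * M + K₀ * Ca1)) / 2 * l2norm f ^ 2 := by
  have hK₀0 : 0 ≤ K₀ := (norm_nonneg _).trans (hK₀ 0)
  have hCs10 : 0 ≤ Cs1 := (norm_nonneg _).trans (hCs1 0)
  have hCa10 : 0 ≤ Ca1 := (norm_nonneg _).trans (hCa1 0)
  have hM0 : 0 ≤ M := hS.M_nonneg
  set P : EuclideanSpace ℝ (Fin d) → (EuclideanSpace ℝ (Fin k) →L[ℝ] EuclideanSpace ℝ (Fin k)) :=
    fun x => (s (w x)).comp (a j (w x)) with hP
  have hpt : ∀ x, ⟪a j (w x) (fderiv ℝ f x (bv j)), s (w x) (f x)⟫ =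
      ⟪f x, P x (fderiv ℝ f x (bv j))⟫ := fun x => by
    rw [← hS.symm_s, real_inner_comm]
    rfl
  simp only [cwd_singleton]
  simp_rw [hpt]
  have hM0' : ∀ x, ‖P x‖ ≤ K₀ * M + (Cs1 * M + K₀ * Ca1) := fun x =>
    (norm_sa_comp_le hS hK₀ j x).trans (le_add_of_nonneg_right (by positivity))
  have hM1' : ∀ x, ‖fderiv ℝ P x (bv j)‖ ≤ K₀ * M + (Cs1 * M + K₀ * Ca1) := fun x =>
    (norm_fderiv_sa_comp_le hS hw hK₀ j j hCs1 hCa1 x).trans (le_add_of_nonneg_left (by positivity))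
  have hfj' : MemLp (fun x => fderiv ℝ f x (bv j)) 2 (volume : Measure (EuclideanSpace ℝ (Fin d))) := hfj
  exact abs_integral_inner_clm_fderiv_le ((contDiff_sa_comp hS hw j).of_le (by exact_mod_cast le_top))
    (inner_sa_comp_comm hS j) hM0' j hM1' (hf.of_le (by exact_mod_cast le_top)) hf2 hfj'

/-- **The static estimate of the pairing.** For smooth fields `w₁, w₂` with `dw = w₁ - w₂ ∈ L²`,
`∂ⱼω ∈ L²`, `G(wᵢ) ∈ L²` with `Σⱼ‖∂ⱼG(wᵢ)‖₂ ≤ D_G`, `‖∂ⱼw₂‖ ≤ R₀`, and the `C¹` bounds of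
`s∘w₁, aⱼ∘w₁`:
`|∫ ⟪-ρ₁⋆ρ₁⋆G(w₁) + ρ₂⋆ρ₂⋆G(w₂), s(w₁)dw⟫| ≤ A‖dw‖₂² + (δ₁+δ₂)(2 D_G K₀)‖dw‖₂` with
`A = d M_P/2 + (dMR₀ + L)K₀`. [cite: Majda1984, Ch. 2 §2.1, (2.17)–(2.19)] -/
theorem abs_integral_diff_le (hS : IsSymmSmoothCoeff M L a b s) {δ₁ δ₂ : ℝ} (hδ₁ : 0 < δ₁)
    (hδ₂ : 0 < δ₂) {w₁ w₂ : EuclideanSpace ℝ (Fin d) → EuclideanSpace ℝ (Fin k)}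
    (hw₁ : ContDiff ℝ ∞ w₁) (hw₂ : ContDiff ℝ ∞ w₂) {K₀ Cs1 Ca1 R₀ DG : ℝ}
    (hK₀ : ∀ y, ‖s y‖ ≤ K₀) (hR₀ : 0 ≤ R₀)
    (hCs1 : ∀ j x, ‖cwd [j] (fun y => s (w₁ y)) x‖ ≤ Cs1)
    (hCa1 : ∀ (j : Fin d) x, ‖cwd [j] (fun y => a j (w₁ y)) x‖ ≤ Ca1)
    (h1sup : ∀ j x, ‖cwd [j] w₂ x‖ ≤ R₀)
    (hdw2 : MemLp (fun x => w₁ x - w₂ x) 2 (volume : Measure (EuclideanSpace ℝ (Fin d))))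
    (hdwj : ∀ j, MemLp (cwd [j] (fun x => w₁ x - w₂ x)) 2 (volume : Measure (EuclideanSpace ℝ (Fin d))))
    (hG₁2 : MemLp (gfield a b w₁) 2 (volume : Measure (EuclideanSpace ℝ (Fin d))))
    (hG₂2 : MemLp (gfield a b w₂) 2 (volume : Measure (EuclideanSpace ℝ (Fin d))))
    (hG₁j : ∀ j, MemLp (cwd [j] (gfield a b w₁)) 2 (volume : Measure (EuclideanSpace ℝ (Fin d))))
    (hG₂j : ∀ j, MemLp (cwd [j] (gfield a b w₂)) 2 (volume : Measure (EuclideanSpace ℝ (Fin d))))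
    (hG₁D : ∑ j, l2norm (cwd [j] (gfield a b w₁)) ≤ DG)
    (hG₂D : ∑ j, l2norm (cwd [j] (gfield a b w₂)) ≤ DG) :
    |∫ x, ⟪-(moll (Fin d) hδ₁ ⋆[lsmul ℝ ℝ, volume] (moll (Fin d) hδ₁ ⋆[lsmul ℝ ℝ, volume]
          gfield a b w₁)) x +
        (moll (Fin d) hδ₂ ⋆[lsmul ℝ ℝ, volume] (moll (Fin d) hδ₂ ⋆[lsmul ℝ ℝ, volume]
          gfield a b w₂)) x, s (w₁ x) (w₁ x - w₂ x)⟫| ≤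
      (d * ((K₀ * M + (Cs1 * M + K₀ * Ca1)) / 2) + (d * M * R₀ + L) * K₀) *
          l2norm (fun x => w₁ x - w₂ x) ^ 2 +
        (δ₁ + δ₂) * (2 * DG * K₀) * l2norm (fun x => w₁ x - w₂ x) := by
  -- names and signs
  have hK₀0 : 0 ≤ K₀ := (norm_nonneg _).trans (hK₀ 0)
  have hM0 : 0 ≤ M := hS.M_nonneg
  have hL0 : 0 ≤ L := hS.L_nonneg
  set ρ₁ := moll (Fin d) hδ₁ with hρ₁
  set ρ₂ := moll (Fin d) hδ₂ with hρ₂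
  set G₁ := gfield a b w₁ with hG₁
  set G₂ := gfield a b w₂ with hG₂
  set dw : EuclideanSpace ℝ (Fin d) → EuclideanSpace ℝ (Fin k) := fun x => w₁ x - w₂ x with hdw
  have hG₁s : ContDiff ℝ ∞ G₁ := contDiff_gfield hS hw₁
  have hG₂s : ContDiff ℝ ∞ G₂ := contDiff_gfield hS hw₂
  have hdws : ContDiff ℝ ∞ dw := hw₁.sub hw₂
  have hdwc : Continuous dw := hdws.continuous
  -- the mollification errors
  obtain ⟨hP1m, hP1le⟩ := l2norm_moll_moll_sub_self_le hδ₁ hG₁s hG₁2 hG₁j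
  obtain ⟨hP2m, hP2le⟩ := l2norm_moll_moll_sub_self_le hδ₂ hG₂s hG₂2 hG₂j
  -- the top and lower parts of `G₁ - G₂`
  set top : EuclideanSpace ℝ (Fin d) → EuclideanSpace ℝ (Fin k) :=
    fun x => ∑ j, a j (w₁ x) (cwd [j] dw x) with htop
  set low : EuclideanSpace ℝ (Fin d) → EuclideanSpace ℝ (Fin k) :=
    fun x => (∑ j, (a j (w₁ x) - a j (w₂ x)) (cwd [j] w₂ x)) + (b (w₁ x) - b (w₂ x)) with hlow
  have hcwddw : ∀ j x, cwd [j] dw x = cwd [j] w₁ x - cwd [j] w₂ x := fun j x => by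
    rw [hdw, cwd_fun_sub hw₁ hw₂]
  have hsplitG : ∀ x, G₁ x - G₂ x = top x + low x := by
    intro x
    have key : ∀ j : Fin d, a j (w₁ x) (cwd [j] w₁ x) - a j (w₂ x) (cwd [j] w₂ x) =
        a j (w₁ x) (cwd [j] w₁ x - cwd [j] w₂ x) + (a j (w₁ x) - a j (w₂ x)) (cwd [j] w₂ x) :=
      fun j => by rw [map_sub, sub_apply]; abel
    calc G₁ x - G₂ x = (∑ j, (a j (w₁ x) (cwd [j] w₁ x) - a j (w₂ x) (cwd [j] w₂ x))) +
          (b (w₁ x) - b (w₂ x)) := by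
          simp only [hG₁, hG₂, gfield, Finset.sum_sub_distrib]; abel
      _ = (∑ j, (a j (w₁ x) (cwd [j] w₁ x - cwd [j] w₂ x) + (a j (w₁ x) - a j (w₂ x)) (cwd [j] w₂ x)))
          + (b (w₁ x) - b (w₂ x)) := by rw [Finset.sum_congr rfl fun j _ => key j]
      _ = top x + low x := by simp only [htop, hlow, hcwddw, Finset.sum_add_distrib]; abel
  -- `L²` facts
  have htopj : ∀ j, MemLp (fun x => a j (w₁ x) (cwd [j] dw x)) 2 (volume : Measure (EuclideanSpace ℝ (Fin d))) :=
    fun j => (memLp_clm_apply_and_l2norm_le ((hS.smooth_a j).continuous.comp hw₁.continuous)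
      (continuous_cwd hdws _) (hdwj j) hM0 (fun x => hS.norm_a j _)).1
  have hlowm : MemLp low 2 (volume : Measure (EuclideanSpace ℝ (Fin d))) ∧
      l2norm low ≤ (d * M * R₀ + L) * l2norm dw := by
    have hcont : Continuous low := by
      refine (continuous_finsetSum _ fun j _ => ?_).add
        ((hS.smooth_b.continuous.comp hw₁.continuous).sub (hS.smooth_b.continuous.comp hw₂.continuous))
      exact (((hS.smooth_a j).continuous.comp hw₁.continuous).sub
        ((hS.smooth_a j).continuous.comp hw₂.continuous)).clm_apply (continuous_cwd hw₂ _)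
    refine memLp_and_l2norm_le_of_le hcont hdw2 (by positivity) fun x => ?_
    calc ‖low x‖ ≤ ∑ j, ‖(a j (w₁ x) - a j (w₂ x)) (cwd [j] w₂ x)‖ + ‖b (w₁ x) - b (w₂ x)‖ :=
          norm_add_le_of_le (norm_sum_le _ _) le_rfl
      _ ≤ ∑ _j : Fin d, M * ‖dw x‖ * R₀ + L * ‖dw x‖ := by
          refine add_le_add (Finset.sum_le_sum fun j _ => ?_) (hS.norm_b_sub_le _ _)
          exact (le_opNorm _ _).trans (mul_le_mul (hS.norm_a_sub_le j _ _) (h1sup j x)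
            (norm_nonneg _) (by positivity))
      _ = (d * M * R₀ + L) * ‖dw x‖ := by simp; ring
  obtain ⟨hsdw, hsdwle⟩ := memLp_clm_apply_and_l2norm_le ((contDiff_s_comp hS hw₁).continuous) hdwc hdw2
    hK₀0 (fun x => hK₀ _)
  -- integrability of the four pairings
  have hiP1 := integrable_inner_of_memLp hP1m hsdw
  have hiP2 := integrable_inner_of_memLp hP2m hsdw
  have hitop : ∀ j, Integrable (fun x => ⟪a j (w₁ x) (cwd [j] dw x), s (w₁ x) (dw x)⟫)
      (volume : Measure (EuclideanSpace ℝ (Fin d))) := fun j => integrable_inner_of_memLp (htopj j) hsdw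
  have hilow := integrable_inner_of_memLp hlowm.1 hsdw
  -- the pointwise splitting of the integrand
  have hpt : ∀ x, ⟪-(ρ₁ ⋆[lsmul ℝ ℝ, volume] (ρ₁ ⋆[lsmul ℝ ℝ, volume] G₁)) x +
      (ρ₂ ⋆[lsmul ℝ ℝ, volume] (ρ₂ ⋆[lsmul ℝ ℝ, volume] G₂)) x, s (w₁ x) (dw x)⟫ =
      -⟪(ρ₁ ⋆[lsmul ℝ ℝ, volume] (ρ₁ ⋆[lsmul ℝ ℝ, volume] G₁)) x - G₁ x, s (w₁ x) (dw x)⟫ +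
        ⟪(ρ₂ ⋆[lsmul ℝ ℝ, volume] (ρ₂ ⋆[lsmul ℝ ℝ, volume] G₂)) x - G₂ x, s (w₁ x) (dw x)⟫ -
        ((∑ j, ⟪a j (w₁ x) (cwd [j] dw x), s (w₁ x) (dw x)⟫) + ⟪low x, s (w₁ x) (dw x)⟫) := by
    intro x
    have h1 : -(ρ₁ ⋆[lsmul ℝ ℝ, volume] (ρ₁ ⋆[lsmul ℝ ℝ, volume] G₁)) x +
        (ρ₂ ⋆[lsmul ℝ ℝ, volume] (ρ₂ ⋆[lsmul ℝ ℝ, volume] G₂)) x =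
        -((ρ₁ ⋆[lsmul ℝ ℝ, volume] (ρ₁ ⋆[lsmul ℝ ℝ, volume] G₁)) x - G₁ x) +
          ((ρ₂ ⋆[lsmul ℝ ℝ, volume] (ρ₂ ⋆[lsmul ℝ ℝ, volume] G₂)) x - G₂ x) - (G₁ x - G₂ x) := by abel
    rw [h1, hsplitG x, inner_sub_left, inner_add_left, inner_neg_left, inner_add_left]
    simp only [htop, sum_inner]
  have hint : ∫ x, ⟪-(ρ₁ ⋆[lsmul ℝ ℝ, volume] (ρ₁ ⋆[lsmul ℝ ℝ, volume] G₁)) x +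
      (ρ₂ ⋆[lsmul ℝ ℝ, volume] (ρ₂ ⋆[lsmul ℝ ℝ, volume] G₂)) x, s (w₁ x) (dw x)⟫ =
      -(∫ x, ⟪(ρ₁ ⋆[lsmul ℝ ℝ, volume] (ρ₁ ⋆[lsmul ℝ ℝ, volume] G₁)) x - G₁ x, s (w₁ x) (dw x)⟫) +
        (∫ x, ⟪(ρ₂ ⋆[lsmul ℝ ℝ, volume] (ρ₂ ⋆[lsmul ℝ ℝ, volume] G₂)) x - G₂ x, s (w₁ x) (dw x)⟫) -
        ((∑ j, ∫ x, ⟪a j (w₁ x) (cwd [j] dw x), s (w₁ x) (dw x)⟫) + ∫ x, ⟪low x, s (w₁ x) (dw x)⟫) := by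
    rw [integral_congr_ae (Eventually.of_forall hpt), integral_sub, integral_add, integral_neg,
      integral_add, integral_finsetSum _ (fun j _ => hitop j)]
    · exact integrable_finsetSum _ fun j _ => hitop j
    · exact hilow
    · exact hiP1.neg
    · exact hiP2
    · exact hiP1.neg.add hiP2
    · exact (integrable_finsetSum _ fun j _ => hitop j).add hilow
  -- bounds
  have hb1 : |∫ x, ⟪(ρ₁ ⋆[lsmul ℝ ℝ, volume] (ρ₁ ⋆[lsmul ℝ ℝ, volume] G₁)) x - G₁ x, s (w₁ x) (dw x)⟫|
      ≤ 2 * δ₁ * DG * (K₀ * l2norm dw) := by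
    refine (abs_integral_inner_s_le hS hw₁ hK₀ hP1m hdwc hdw2).trans ?_
    refine mul_le_mul_of_nonneg_right (hP1le.trans ?_) (mul_nonneg hK₀0 (l2norm_nonneg _))
    exact mul_le_mul_of_nonneg_left hG₁D (by positivity)
  have hb2 : |∫ x, ⟪(ρ₂ ⋆[lsmul ℝ ℝ, volume] (ρ₂ ⋆[lsmul ℝ ℝ, volume] G₂)) x - G₂ x, s (w₁ x) (dw x)⟫|
      ≤ 2 * δ₂ * DG * (K₀ * l2norm dw) := by
    refine (abs_integral_inner_s_le hS hw₁ hK₀ hP2m hdwc hdw2).trans ?_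
    refine mul_le_mul_of_nonneg_right (hP2le.trans ?_) (mul_nonneg hK₀0 (l2norm_nonneg _))
    exact mul_le_mul_of_nonneg_left hG₂D (by positivity)
  have hb3 : |∑ j, ∫ x, ⟪a j (w₁ x) (cwd [j] dw x), s (w₁ x) (dw x)⟫| ≤
      d * ((K₀ * M + (Cs1 * M + K₀ * Ca1)) / 2 * l2norm dw ^ 2) := by
    refine (Finset.abs_sum_le_sum_abs _ _).trans ?_
    calc ∑ j, |∫ x, ⟪a j (w₁ x) (cwd [j] dw x), s (w₁ x) (dw x)⟫|
        ≤ ∑ _j : Fin d, (K₀ * M + (Cs1 * M + K₀ * Ca1)) / 2 * l2norm dw ^ 2 :=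
          Finset.sum_le_sum fun j _ => abs_integral_top_le' hS hw₁ hK₀ j (hCs1 j) (hCa1 j) hdws hdw2 (hdwj j)
      _ = d * ((K₀ * M + (Cs1 * M + K₀ * Ca1)) / 2 * l2norm dw ^ 2) := by simp
  have hb4 : |∫ x, ⟪low x, s (w₁ x) (dw x)⟫| ≤ (d * M * R₀ + L) * l2norm dw * (K₀ * l2norm dw) :=
    (abs_integral_inner_s_le hS hw₁ hK₀ hlowm.1 hdwc hdw2).trans
      (mul_le_mul_of_nonneg_right hlowm.2 (mul_nonneg hK₀0 (l2norm_nonneg _)))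
  rw [hint]
  have hdw0 : 0 ≤ l2norm dw := l2norm_nonneg _
  calc |-(∫ x, ⟪(ρ₁ ⋆[lsmul ℝ ℝ, volume] (ρ₁ ⋆[lsmul ℝ ℝ, volume] G₁)) x - G₁ x, s (w₁ x) (dw x)⟫) +
        (∫ x, ⟪(ρ₂ ⋆[lsmul ℝ ℝ, volume] (ρ₂ ⋆[lsmul ℝ ℝ, volume] G₂)) x - G₂ x, s (w₁ x) (dw x)⟫) -
        ((∑ j, ∫ x, ⟪a j (w₁ x) (cwd [j] dw x), s (w₁ x) (dw x)⟫) + ∫ x, ⟪low x, s (w₁ x) (dw x)⟫)|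
      ≤ |(∫ x, ⟪(ρ₁ ⋆[lsmul ℝ ℝ, volume] (ρ₁ ⋆[lsmul ℝ ℝ, volume] G₁)) x - G₁ x, s (w₁ x) (dw x)⟫)| +
        |(∫ x, ⟪(ρ₂ ⋆[lsmul ℝ ℝ, volume] (ρ₂ ⋆[lsmul ℝ ℝ, volume] G₂)) x - G₂ x, s (w₁ x) (dw x)⟫)| +
        (|∑ j, ∫ x, ⟪a j (w₁ x) (cwd [j] dw x), s (w₁ x) (dw x)⟫| + |∫ x, ⟪low x, s (w₁ x) (dw x)⟫|) := by
        refine (abs_sub _ _).trans (add_le_add ((abs_add_le _ _).trans (by rw [abs_neg])) (abs_add_le _ _))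
    _ ≤ 2 * δ₁ * DG * (K₀ * l2norm dw) + 2 * δ₂ * DG * (K₀ * l2norm dw) +
        (d * ((K₀ * M + (Cs1 * M + K₀ * Ca1)) / 2 * l2norm dw ^ 2) +
          (d * M * R₀ + L) * l2norm dw * (K₀ * l2norm dw)) := add_le_add (add_le_add hb1 hb2) (add_le_add hb3 hb4)
    _ = (d * ((K₀ * M + (Cs1 * M + K₀ * Ca1)) / 2) + (d * M * R₀ + L) * K₀) * l2norm dw ^ 2 +
        (δ₁ + δ₂) * (2 * DG * K₀) * l2norm dw := by ring

/-! ### Grönwall on `[-T, T]` -/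

/-- **Two-sided Grönwall**: if `Φ ≥ 0` is differentiable with `|Φ'| ≤ γ Φ` on `[-T, T]` then
`Φ(t) ≤ e^{γ|t|} Φ(0)` for `|t| ≤ T`. [folklore] -/
theorem gronwall_two_sided {Φ Φ' : ℝ → ℝ} {γ T : ℝ} (hΦ0 : ∀ t, 0 ≤ Φ t)
    (hd : ∀ t, HasDerivAt Φ (Φ' t) t) (hb : ∀ t ∈ Icc (-T) T, |Φ' t| ≤ γ * Φ t) :
    ∀ t ∈ Icc (-T) T, Φ t ≤ Real.exp (γ * |t|) * Φ 0 := by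
  -- forward
  have hfwd : ∀ {Ψ Ψ' : ℝ → ℝ}, (∀ t, 0 ≤ Ψ t) → (∀ t, HasDerivAt Ψ (Ψ' t) t) →
      (∀ t ∈ Icc 0 T, |Ψ' t| ≤ γ * Ψ t) → ∀ t ∈ Icc 0 T, Ψ t ≤ Real.exp (γ * t) * Ψ 0 := by
    intro Ψ Ψ' hΨ0 hΨd hΨb t ht
    have hcont : ContinuousOn Ψ (Icc 0 T) := fun x _ => (hΨd x).continuousAt.continuousWithinAt
    have hder : ∀ x ∈ Ico 0 T, HasDerivWithinAt Ψ (Ψ' x) (Ici x) x := fun x _ => (hΨd x).hasDerivWithinAt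
    have hbound : ∀ x ∈ Ico 0 T, ‖Ψ' x‖ ≤ γ * ‖Ψ x‖ + 0 := by
      intro x hx
      rw [add_zero, Real.norm_eq_abs, Real.norm_eq_abs, abs_of_nonneg (hΨ0 x)]
      exact hΨb x (Ico_subset_Icc_self hx)
    have hg := norm_le_gronwallBound_of_norm_deriv_right_le hcont hder le_rfl hbound t ht
    rw [gronwallBound_ε0, sub_zero, Real.norm_eq_abs, Real.norm_eq_abs, abs_of_nonneg (hΨ0 t),
      abs_of_nonneg (hΨ0 0)] at hg
    linarith
  intro t ht
  rcases le_or_gt 0 t with ht0 | ht0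
  · rw [abs_of_nonneg ht0]
    exact hfwd hΦ0 hd (fun τ hτ => hb τ ⟨by linarith [hτ.1, hτ.2], hτ.2⟩) t ⟨ht0, ht.2⟩
  · have h := hfwd (Ψ := fun τ => Φ (-τ)) (Ψ' := fun τ => -Φ' (-τ)) (fun τ => hΦ0 _)
      (fun τ => by
        have h' : HasDerivAt (fun σ => Φ (-σ)) (Φ' (-τ) * -1) τ := (hd (-τ)).comp τ (hasDerivAt_neg τ)
        simpa using h')
      (fun τ hτ => by rw [abs_neg]; exact hb _ ⟨by linarith [hτ.2], by linarith [hτ.1, hτ.2]⟩) (-t)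
      ⟨by linarith, by linarith [ht.1]⟩
    rw [abs_of_neg ht0]
    simpa using h


/-! ### The `L²`-Cauchy estimate along the flows -/

/-- The difference curve `Ω(t) = ρ_{δ₁} ⋆ U₁(t) - ρ_{δ₂} ⋆ U₂(t)` in `L²` is represented by the
smooth difference `W₁(t) - W₂(t)`. [folklore] -/
theorem coeFn_mollL2_sub {δ₁ δ₂ : ℝ} (hδ₁ : 0 < δ₁) (hδ₂ : 0 < δ₂)
    (V₁ V₂ : Lp (EuclideanSpace ℝ (Fin k)) 2 (volume : Measure (EuclideanSpace ℝ (Fin d)))) :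
    ((mollL2 hδ₁ V₁ - mollL2 hδ₂ V₂ : Lp (EuclideanSpace ℝ (Fin k)) 2
      (volume : Measure (EuclideanSpace ℝ (Fin d)))) : EuclideanSpace ℝ (Fin d) → EuclideanSpace ℝ (Fin k))
      =ᵐ[volume] fun x => smoothRep (moll (Fin d) hδ₁) V₁ x - smoothRep (moll (Fin d) hδ₂) V₂ x := by
  filter_upwards [Lp.coeFn_sub (mollL2 hδ₁ V₁) (mollL2 hδ₂ V₂),
    coeFn_convL2 (continuous_moll hδ₁) (hasCompactSupport_moll hδ₁) V₁,
    coeFn_convL2 (continuous_moll hδ₂) (hasCompactSupport_moll hδ₂) V₂] with x hx h1 h2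
  rw [hx, Pi.sub_apply]
  change (mollL2 hδ₁ V₁ : EuclideanSpace ℝ (Fin d) → EuclideanSpace ℝ (Fin k)) x -
    (mollL2 hδ₂ V₂ : EuclideanSpace ℝ (Fin d) → EuclideanSpace ℝ (Fin k)) x = _
  rw [mollL2, mollL2, h1, h2, smoothRep_def, smoothRep_def]

/-- The derivative of the difference curve is represented by `-ρ₁⋆ρ₁⋆G(W₁) + ρ₂⋆ρ₂⋆G(W₂)`.
[cite: TaylorPDEIII2011, Ch. 16 §1, (1.16)] -/
theorem coeFn_mollL2_regField_sub (h : IsTameCoeff M L a b) {δ₁ δ₂ : ℝ} (hδ₁ : 0 < δ₁)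
    (hδ₂ : 0 < δ₂) (V₁ V₂ : Lp (EuclideanSpace ℝ (Fin k)) 2 (volume : Measure (EuclideanSpace ℝ (Fin d)))) :
    ((mollL2 hδ₁ (regField h hδ₁ V₁) - mollL2 hδ₂ (regField h hδ₂ V₂) :
      Lp (EuclideanSpace ℝ (Fin k)) 2 (volume : Measure (EuclideanSpace ℝ (Fin d)))) :
        EuclideanSpace ℝ (Fin d) → EuclideanSpace ℝ (Fin k)) =ᵐ[volume] fun x =>
      -(moll (Fin d) hδ₁ ⋆[lsmul ℝ ℝ, volume] (moll (Fin d) hδ₁ ⋆[lsmul ℝ ℝ, volume]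
          gfield a b (smoothRep (moll (Fin d) hδ₁) V₁))) x +
        (moll (Fin d) hδ₂ ⋆[lsmul ℝ ℝ, volume] (moll (Fin d) hδ₂ ⋆[lsmul ℝ ℝ, volume]
          gfield a b (smoothRep (moll (Fin d) hδ₂) V₂))) x := by
  filter_upwards [coeFn_mollL2_sub hδ₁ hδ₂ (regField h hδ₁ V₁) (regField h hδ₂ V₂)] with x hx
  rw [hx, smoothRep_regField_eq h hδ₁ V₁, smoothRep_regField_eq h hδ₂ V₂]
  beta_reduce
  rw [sub_neg_eq_add]

set_option maxHeartbeats 400000 in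
/-- **The Cauchy estimate at one time** (all constants explicit): along two regularised flows
from the same datum, at a time where both energies are `≤ 1`, the weighted energy
`Φ = ⟪S(W₁)Ω, Ω⟫ + (δ₁+δ₂)²` of the difference `Ω = ρ₁⋆U₁ - ρ₂⋆U₂` has `|Φ'| ≤ γ Φ`.
[cite: Majda1984, Ch. 2 §2.1, Thm 2.1 (proof, Step 2)]; [cite: TaylorPDEIII2011, Ch. 16 §1, (1.17)–(1.19)] -/
theorem cauchy_deriv_bound_at (hS : IsSymmSmoothCoeff M L a b s) {m q : ℕ} (hq : 1 ≤ q)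
    (hmq : m ≤ 2 * q) (hqm : q + 2 * (d + 1) ≤ m) (hm2 : 2 ≤ m)
    {K₀ K₁ R₀ Ca Ca' Cb Cs' c₀ : ℝ} (hK₀ : ∀ y, ‖s y‖ ≤ K₀) (hK₁0 : 0 ≤ K₁)
    (hK₁ : ∀ y, ‖fderiv ℝ s y‖ ≤ K₁) (hR₀ : Real.sqrt (supConst (Fin d) (EuclideanSpace ℝ (Fin k))) ≤ R₀)
    (hCa0 : 0 ≤ Ca) (hCa'0 : 0 ≤ Ca') (hCb0 : 0 ≤ Cb) (hCs'0 : 0 ≤ Cs') (hc₀ : 0 < c₀)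
    (hcoer : ∀ y (v : EuclideanSpace ℝ (Fin k)), c₀ * ‖v‖ ^ 2 ≤ ⟪s y v, v⟫)
    (hTa : ∀ (j : Fin d) (h : EuclideanSpace ℝ (Fin d) → EuclideanSpace ℝ (Fin k)), ContDiff ℝ ∞ h →
      (∀ c : List (Fin d), 1 ≤ c.length → c.length ≤ q → ∀ x, ‖cwd c h x‖ ≤ R₀) →
      ∀ Y : ℝ, 0 ≤ Y → (∀ c : List (Fin d), 1 ≤ c.length → c.length ≤ m - 1 →
        MemLp (cwd c h) 2 (volume : Measure (EuclideanSpace ℝ (Fin d))) ∧ l2norm (cwd c h) ≤ Y) →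
      ∀ v : List (Fin d), 1 ≤ v.length → v.length ≤ m - 1 →
        MemLp (cwd v (fun y => a j (h y))) 2 (volume : Measure (EuclideanSpace ℝ (Fin d))) ∧
          l2norm (cwd v (fun y => a j (h y))) ≤ Ca * Y)
    (hSa : ∀ (j : Fin d) (h : EuclideanSpace ℝ (Fin d) → EuclideanSpace ℝ (Fin k)), ContDiff ℝ ∞ h →
      (∀ c : List (Fin d), 1 ≤ c.length → c.length ≤ q → ∀ x, ‖cwd c h x‖ ≤ R₀) →
      ∀ v : List (Fin d), v.length ≤ q → ∀ x, ‖cwd v (fun y => a j (h y)) x‖ ≤ Ca')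
    (hTb : ∀ (h : EuclideanSpace ℝ (Fin d) → EuclideanSpace ℝ (Fin k)), ContDiff ℝ ∞ h →
      (∀ c : List (Fin d), 1 ≤ c.length → c.length ≤ q → ∀ x, ‖cwd c h x‖ ≤ R₀) →
      ∀ Y : ℝ, 0 ≤ Y → (∀ c : List (Fin d), 1 ≤ c.length → c.length ≤ m - 1 →
        MemLp (cwd c h) 2 (volume : Measure (EuclideanSpace ℝ (Fin d))) ∧ l2norm (cwd c h) ≤ Y) →
      ∀ v : List (Fin d), 1 ≤ v.length → v.length ≤ m - 1 →
        MemLp (cwd v (fun y => b (h y))) 2 (volume : Measure (EuclideanSpace ℝ (Fin d))) ∧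
          l2norm (cwd v (fun y => b (h y))) ≤ Cb * Y)
    (hSs : ∀ (h : EuclideanSpace ℝ (Fin d) → EuclideanSpace ℝ (Fin k)), ContDiff ℝ ∞ h →
      (∀ c : List (Fin d), 1 ≤ c.length → c.length ≤ q → ∀ x, ‖cwd c h x‖ ≤ R₀) →
      ∀ v : List (Fin d), v.length ≤ q → ∀ x, ‖cwd v (fun y => s (h y)) x‖ ≤ Cs')
    {δ₁ δ₂ : ℝ} (hδ₁ : 0 < δ₁) (hδ₂ : 0 < δ₂) (hu₀ : ContDiff ℝ ∞ u₀) (hu₀c : HasCompactSupport u₀)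
    {U₁ U₂ : ℝ → Lp (EuclideanSpace ℝ (Fin k)) 2 (volume : Measure (EuclideanSpace ℝ (Fin d)))}
    (hU₁0 : U₁ 0 = dataL2 hu₀ hu₀c) (hU₂0 : U₂ 0 = dataL2 hu₀ hu₀c)
    (hU₁ : ∀ t, HasDerivAt U₁ (regField hS.toIsTameCoeff hδ₁ (U₁ t)) t)
    (hU₂ : ∀ t, HasDerivAt U₂ (regField hS.toIsTameCoeff hδ₂ (U₂ t)) t) (t : ℝ)
    (hE₁ : ∑ α ∈ wordsLE (Fin d) m, ‖dcurve hS.toIsTameCoeff hδ₁ hu₀ hu₀c U₁ α t‖ ^ 2 ≤ 1)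
    (hE₂ : ∑ α ∈ wordsLE (Fin d) m, ‖dcurve hS.toIsTameCoeff hδ₂ hu₀ hu₀c U₂ α t‖ ^ 2 ≤ 1)
    {Ω Ω' : Lp (EuclideanSpace ℝ (Fin k)) 2 (volume : Measure (EuclideanSpace ℝ (Fin d)))}
    (hΩ : Ω = mollL2 hδ₁ (U₁ t) - mollL2 hδ₂ (U₂ t))
    (hΩ' : Ω' = mollL2 hδ₁ (regField hS.toIsTameCoeff hδ₁ (U₁ t)) -
      mollL2 hδ₂ (regField hS.toIsTameCoeff hδ₂ (U₂ t))) :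
    |⟪weightOpDeriv hS hδ₁ (U₁ t) Ω, Ω⟫ + 2 * ⟪weightOp hS hδ₁ (U₁ t) Ω', Ω⟫| ≤
      ((K₁ * ((d * M + L) * R₀) +
          2 * (d * ((K₀ * M + (Cs' * M + K₀ * Ca')) / 2) + (d * M * R₀ + L) * K₀) +
          2 * (d * (d * M * 1 + (d * 2 ^ (m - 1) * (Ca * R₀ + Ca') + (Cb + L)))) * K₀) / c₀ +
        2 * (d * (d * M * 1 + (d * 2 ^ (m - 1) * (Ca * R₀ + Ca') + (Cb + L)))) * K₀) *
      (⟪weightOp hS hδ₁ (U₁ t) Ω, Ω⟫ + (δ₁ + δ₂) ^ 2) := by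
  -- opaque constants
  obtain ⟨Clow, hClow⟩ : ∃ x : ℝ, x = d * 2 ^ (m - 1) * (Ca * R₀ + Ca') + (Cb + L) := ⟨_, rfl⟩
  obtain ⟨MP, hMP⟩ : ∃ x : ℝ, x = K₀ * M + (Cs' * M + K₀ * Ca') := ⟨_, rfl⟩
  obtain ⟨DG₁, hDG₁⟩ : ∃ x : ℝ, x = d * M * 1 + Clow := ⟨_, rfl⟩
  obtain ⟨DG, hDG⟩ : ∃ x : ℝ, x = d * DG₁ := ⟨_, rfl⟩
  -- names
  set ρ₁ := moll (Fin d) hδ₁ with hρ₁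
  set ρ₂ := moll (Fin d) hδ₂ with hρ₂
  set W₁ := smoothRep ρ₁ (U₁ t) with hW₁
  set W₂ := smoothRep ρ₂ (U₂ t) with hW₂
  -- signs
  have hK₀0 : 0 ≤ K₀ := (norm_nonneg _).trans (hK₀ 0)
  have hM0 : 0 ≤ M := hS.M_nonneg
  have hL0 : 0 ≤ L := hS.L_nonneg
  have hR₀0 : 0 ≤ R₀ := (Real.sqrt_nonneg _).trans hR₀
  have hd0 : (0 : ℝ) ≤ d := Nat.cast_nonneg d
  have hClow0 : 0 ≤ Clow := by rw [hClow]; positivity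
  have hMP0 : 0 ≤ MP := by rw [hMP]; positivity
  have hDG₁0 : 0 ≤ DG₁ := by rw [hDG₁]; positivity
  have hDG0 : 0 ≤ DG := by rw [hDG]; positivity
  -- smoothness
  have hW₁s : ContDiff ℝ ∞ W₁ := contDiff_smoothRep (contDiff_moll hδ₁) (hasCompactSupport_moll hδ₁) _
  have hW₂s : ContDiff ℝ ∞ W₂ := contDiff_smoothRep (contDiff_moll hδ₂) (hasCompactSupport_moll hδ₂) _
  -- controls of `W₁`, `W₂` from the energies
  have hsup₁ : ∀ c : List (Fin d), c.length ≤ q → ∀ x, ‖cwd c W₁ x‖ ≤ R₀ := by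
    intro c hc x
    have h1 := norm_cwd_smoothRep_flow_le_sqrt hS.toIsTameCoeff hδ₁ hu₀ hu₀c hU₁0 hU₁ c (m := m) (by omega) t x
    refine h1.trans (le_trans (Real.sqrt_le_sqrt ?_) hR₀)
    exact mul_le_of_le_one_right supConst_nonneg hE₁
  have hsup₂ : ∀ c : List (Fin d), c.length ≤ q → ∀ x, ‖cwd c W₂ x‖ ≤ R₀ := by
    intro c hc x
    have h1 := norm_cwd_smoothRep_flow_le_sqrt hS.toIsTameCoeff hδ₂ hu₀ hu₀c hU₂0 hU₂ c (m := m) (by omega) t x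
    refine h1.trans (le_trans (Real.sqrt_le_sqrt ?_) hR₀)
    exact mul_le_of_le_one_right supConst_nonneg hE₂
  have hL2₁ : ∀ c : List (Fin d), c.length ≤ m →
      MemLp (cwd c W₁) 2 (volume : Measure (EuclideanSpace ℝ (Fin d))) ∧ l2norm (cwd c W₁) ≤ 1 := by
    intro c hc
    have h1 := l2norm_cwd_smoothRep_flow_le_sqrt hS.toIsTameCoeff hδ₁ hu₀ hu₀c hU₁0 hU₁ c hc t
    exact ⟨h1.1, h1.2.trans ((Real.sqrt_le_sqrt hE₁).trans_eq Real.sqrt_one)⟩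
  have hL2₂ : ∀ c : List (Fin d), c.length ≤ m →
      MemLp (cwd c W₂) 2 (volume : Measure (EuclideanSpace ℝ (Fin d))) ∧ l2norm (cwd c W₂) ≤ 1 := by
    intro c hc
    have h1 := l2norm_cwd_smoothRep_flow_le_sqrt hS.toIsTameCoeff hδ₂ hu₀ hu₀c hU₂0 hU₂ c hc t
    exact ⟨h1.1, h1.2.trans ((Real.sqrt_le_sqrt hE₂).trans_eq Real.sqrt_one)⟩
  -- `∂ⱼG(Wᵢ) ∈ L²` with a uniform bound, via the static bounds at order `m - 1` with `D = 1`
  have hGj : ∀ {δ : ℝ} (hδ : 0 < δ) {U : ℝ → Lp (EuclideanSpace ℝ (Fin k)) 2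
      (volume : Measure (EuclideanSpace ℝ (Fin d)))}, U 0 = dataL2 hu₀ hu₀c →
      (∀ τ, HasDerivAt U (regField hS.toIsTameCoeff hδ (U τ)) τ) →
      ∑ α ∈ wordsLE (Fin d) m, ‖dcurve hS.toIsTameCoeff hδ hu₀ hu₀c U α t‖ ^ 2 ≤ 1 →
      (∀ c : List (Fin d), c.length ≤ q → ∀ x, ‖cwd c (smoothRep (moll (Fin d) hδ) (U t)) x‖ ≤ R₀) →
      (∀ c : List (Fin d), c.length ≤ m →
        MemLp (cwd c (smoothRep (moll (Fin d) hδ) (U t))) 2 (volume : Measure (EuclideanSpace ℝ (Fin d))) ∧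
          l2norm (cwd c (smoothRep (moll (Fin d) hδ) (U t))) ≤ 1) →
      ∀ j : Fin d, MemLp (cwd [j] (gfield a b (smoothRep (moll (Fin d) hδ) (U t)))) 2
          (volume : Measure (EuclideanSpace ℝ (Fin d))) ∧
        l2norm (cwd [j] (gfield a b (smoothRep (moll (Fin d) hδ) (U t)))) ≤ DG₁ := by
    intro δ hδ U hU0 hU hE hsup hL2 j
    have hWs : ContDiff ℝ ∞ (smoothRep (moll (Fin d) hδ) (U t)) :=
      contDiff_smoothRep (contDiff_moll hδ) (hasCompactSupport_moll hδ) _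
    have hsup1 : ∀ c : List (Fin d), 1 ≤ c.length → c.length ≤ q → ∀ x,
        ‖cwd c (smoothRep (moll (Fin d) hδ) (U t)) x‖ ≤ R₀ := fun c _ hc x => hsup c hc x
    have hL2m : ∀ c : List (Fin d), c.length ≤ m - 1 →
        MemLp (cwd c (smoothRep (moll (Fin d) hδ) (U t))) 2 (volume : Measure (EuclideanSpace ℝ (Fin d))) ∧
          l2norm (cwd c (smoothRep (moll (Fin d) hδ) (U t))) ≤ 1 := fun c hc => hL2 c (by omega)
    have hL2m1 : ∀ c : List (Fin d), 1 ≤ c.length → c.length ≤ m - 1 →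
        MemLp (cwd c (smoothRep (moll (Fin d) hδ) (U t))) 2 (volume : Measure (EuclideanSpace ℝ (Fin d))) ∧
          l2norm (cwd c (smoothRep (moll (Fin d) hδ) (U t))) ≤ 1 := fun c _ hc => hL2m c hc
    have hL2' : ∀ (j : Fin d) (c : List (Fin d)), c.length ≤ m - 1 →
        MemLp (cwd (j :: c) (smoothRep (moll (Fin d) hδ) (U t))) 2 (volume : Measure (EuclideanSpace ℝ (Fin d))) ∧
          l2norm (cwd (j :: c) (smoothRep (moll (Fin d) hδ) (U t))) ≤ 1 * 1 := by
      intro j c hc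
      rw [one_mul]
      exact hL2 (j :: c) (by simp; omega)
    have h := memLp_cwd_gfield hS hWs (m := m - 1) (q := q) (by omega) hR₀0 zero_le_one hCa0 hCa'0 hCb0
      hsup hL2m hL2' (fun j' => hTa j' _ hWs hsup1 1 zero_le_one hL2m1) (fun j' => hSa j' _ hWs hsup1)
      (hTb _ hWs hsup1 1 zero_le_one hL2m1) (α := [j]) (by simp; omega)
    exact ⟨h.1, h.2.trans_eq (by rw [hDG₁, hClow]; ring)⟩
  have hG₁j := hGj hδ₁ hU₁0 hU₁ hE₁ hsup₁ hL2₁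
  have hG₂j := hGj hδ₂ hU₂0 hU₂ hE₂ hsup₂ hL2₂
  -- the static estimate
  have hCs1 : ∀ (j : Fin d) (x : EuclideanSpace ℝ (Fin d)), ‖cwd [j] (fun y => s (W₁ y)) x‖ ≤ Cs' :=
    fun j x => hSs W₁ hW₁s (fun c _ hc x => hsup₁ c hc x) [j] (by simpa using hq) x
  have hCa1 : ∀ (j : Fin d) (x : EuclideanSpace ℝ (Fin d)), ‖cwd [j] (fun y => a j (W₁ y)) x‖ ≤ Ca' :=
    fun j x => hSa j W₁ hW₁s (fun c _ hc x => hsup₁ c hc x) [j] (by simpa using hq) x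
  have hdw2 : MemLp (fun x => W₁ x - W₂ x) 2 (volume : Measure (EuclideanSpace ℝ (Fin d))) := by
    have h1 := (hL2₁ [] (by simp)).1
    have h2 := (hL2₂ [] (by simp)).1
    rw [cwd_nil] at h1 h2
    exact h1.sub h2
  have hdwj : ∀ j, MemLp (cwd [j] (fun x => W₁ x - W₂ x)) 2 (volume : Measure (EuclideanSpace ℝ (Fin d))) :=
      fun j => by
    rw [cwd_fun_sub hW₁s hW₂s]
    exact (hL2₁ [j] (by simpa using le_trans hq (by omega))).1.sub
      (hL2₂ [j] (by simpa using le_trans hq (by omega))).1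
  have hstat := abs_integral_diff_le hS hδ₁ hδ₂ hW₁s hW₂s hK₀ hR₀0 hCs1 hCa1
    (fun j x => hsup₂ [j] (by simpa using hq) x) hdw2 hdwj
    (memLp_gfield_smoothRep hS.toIsTameCoeff hδ₁ (U₁ t)).1 (memLp_gfield_smoothRep hS.toIsTameCoeff hδ₂ (U₂ t)).1
    (fun j => (hG₁j j).1) (fun j => (hG₂j j).1) (DG := DG)
    ((Finset.sum_le_sum fun j _ => (hG₁j j).2).trans (le_of_eq (by rw [hDG]; simp)))
    ((Finset.sum_le_sum fun j _ => (hG₂j j).2).trans (le_of_eq (by rw [hDG]; simp)))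
  -- the representatives of `Ω` and `Ω'`
  have hΩae : (Ω : EuclideanSpace ℝ (Fin d) → EuclideanSpace ℝ (Fin k)) =ᵐ[volume]
      fun x => W₁ x - W₂ x := by
    rw [hΩ]
    exact coeFn_mollL2_sub hδ₁ hδ₂ (U₁ t) (U₂ t)
  have hΩ'ae : (Ω' : EuclideanSpace ℝ (Fin d) → EuclideanSpace ℝ (Fin k)) =ᵐ[volume] fun x =>
      -(ρ₁ ⋆[lsmul ℝ ℝ, volume] (ρ₁ ⋆[lsmul ℝ ℝ, volume] gfield a b W₁)) x +
        (ρ₂ ⋆[lsmul ℝ ℝ, volume] (ρ₂ ⋆[lsmul ℝ ℝ, volume] gfield a b W₂)) x := by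
    rw [hΩ']
    exact coeFn_mollL2_regField_sub hS.toIsTameCoeff hδ₁ hδ₂ (U₁ t) (U₂ t)
  have hΩn : ‖Ω‖ = l2norm (fun x => W₁ x - W₂ x) := by
    rw [Lp.norm_def, l2norm_def, eLpNorm_congr_ae hΩae]
  -- (A) the weight-derivative term
  have hGsup : ∀ y, ‖gfield a b W₁ y‖ ≤ (d * M + L) * R₀ := fun y =>
    norm_gfield_le hS (fun x => by simpa using hsup₁ [] (by simp) x) (fun j x => hsup₁ [j] (by simpa using hq) x) y
  have hRF : ∀ x, ‖smoothRep ρ₁ (regField hS.toIsTameCoeff hδ₁ (U₁ t)) x‖ ≤ (d * M + L) * R₀ :=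
    norm_smoothRep_regField_le hS.toIsTameCoeff hδ₁ (U₁ t) (contDiff_gfield hS hW₁s).continuous hGsup
  obtain ⟨A₀, hA₀⟩ : ∃ x : ℝ, x = K₁ * ((d * M + L) * R₀) := ⟨_, rfl⟩
  obtain ⟨B₀, hB₀⟩ : ∃ x : ℝ, x = d * (MP / 2) + (d * M * R₀ + L) * K₀ := ⟨_, rfl⟩
  have hA₀0 : 0 ≤ A₀ := by rw [hA₀]; positivity
  have hB₀0 : 0 ≤ B₀ := by rw [hB₀]; positivity
  have hA : |⟪weightOpDeriv hS hδ₁ (U₁ t) Ω, Ω⟫| ≤ A₀ * ‖Ω‖ ^ 2 := by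
    rw [hA₀]
    calc |⟪weightOpDeriv hS hδ₁ (U₁ t) Ω, Ω⟫| ≤ ‖weightOpDeriv hS hδ₁ (U₁ t) Ω‖ * ‖Ω‖ :=
          abs_real_inner_le_norm _ _
      _ ≤ K₁ * ((d * M + L) * R₀) * ‖Ω‖ * ‖Ω‖ :=
          mul_le_mul_of_nonneg_right (norm_weightOpDeriv_apply_le_of_sup hS hδ₁ hK₁0 hK₁ (U₁ t) hRF Ω)
            (norm_nonneg _)
      _ = K₁ * ((d * M + L) * R₀) * ‖Ω‖ ^ 2 := by ring
  -- (B) the main term through the representatives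
  have hB : |⟪weightOp hS hδ₁ (U₁ t) Ω', Ω⟫| ≤
      B₀ * ‖Ω‖ ^ 2 + (δ₁ + δ₂) * (2 * DG * K₀) * ‖Ω‖ := by
    rw [hB₀, hMP, inner_weightOp_comm, L2.inner_def]
    have heq : ∫ x, ⟪(Ω' : EuclideanSpace ℝ (Fin d) → EuclideanSpace ℝ (Fin k)) x,
        (weightOp hS hδ₁ (U₁ t) Ω : EuclideanSpace ℝ (Fin d) → EuclideanSpace ℝ (Fin k)) x⟫ =
        ∫ x, ⟪-(ρ₁ ⋆[lsmul ℝ ℝ, volume] (ρ₁ ⋆[lsmul ℝ ℝ, volume] gfield a b W₁)) x +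
          (ρ₂ ⋆[lsmul ℝ ℝ, volume] (ρ₂ ⋆[lsmul ℝ ℝ, volume] gfield a b W₂)) x, s (W₁ x) (W₁ x - W₂ x)⟫ := by
      refine integral_congr_ae ?_
      filter_upwards [hΩ'ae, coeFn_weightOp hS hδ₁ (U₁ t) Ω, hΩae] with x h1 h2 h3
      rw [h1, h2, h3]
    rw [heq, hΩn]
    exact hstat
  -- assembling `|Φ'| ≤ γ Φ`
  have hΦ : c₀ * ‖Ω‖ ^ 2 ≤ ⟪weightOp hS hδ₁ (U₁ t) Ω, Ω⟫ := inner_weightOp_self_ge hS hδ₁ hcoer (U₁ t) Ω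
  have hΩsq : ‖Ω‖ ^ 2 ≤ ⟪weightOp hS hδ₁ (U₁ t) Ω, Ω⟫ / c₀ := by
    rw [le_div_iff₀ hc₀, mul_comm]; exact hΦ
  have hE0 : 0 ≤ ⟪weightOp hS hδ₁ (U₁ t) Ω, Ω⟫ := le_trans (by positivity) hΦ
  have hδ0 : 0 ≤ δ₁ + δ₂ := by positivity
  have hDK0 : 0 ≤ DG * K₀ := mul_nonneg hDG0 hK₀0
  -- (1) the two terms
  have h1 : |⟪weightOpDeriv hS hδ₁ (U₁ t) Ω, Ω⟫ + 2 * ⟪weightOp hS hδ₁ (U₁ t) Ω', Ω⟫| ≤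
      A₀ * ‖Ω‖ ^ 2 + 2 * (B₀ * ‖Ω‖ ^ 2 + (δ₁ + δ₂) * (2 * DG * K₀) * ‖Ω‖) := by
    calc |⟪weightOpDeriv hS hδ₁ (U₁ t) Ω, Ω⟫ + 2 * ⟪weightOp hS hδ₁ (U₁ t) Ω', Ω⟫|
        ≤ |⟪weightOpDeriv hS hδ₁ (U₁ t) Ω, Ω⟫| + 2 * |⟪weightOp hS hδ₁ (U₁ t) Ω', Ω⟫| := by
          refine (abs_add_le _ _).trans ?_
          rw [abs_mul, abs_two]
      _ ≤ A₀ * ‖Ω‖ ^ 2 + 2 * (B₀ * ‖Ω‖ ^ 2 + (δ₁ + δ₂) * (2 * DG * K₀) * ‖Ω‖) :=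
          add_le_add hA (mul_le_mul_of_nonneg_left hB (by norm_num))
  -- (2) the cross term by `2ab ≤ a² + b²`
  have h2 : (δ₁ + δ₂) * (2 * DG * K₀) * ‖Ω‖ ≤ DG * K₀ * (‖Ω‖ ^ 2 + (δ₁ + δ₂) ^ 2) := by
    have h := two_mul_le_add_sq ‖Ω‖ (δ₁ + δ₂)
    have h' := mul_le_mul_of_nonneg_left h hDK0
    have heq : (δ₁ + δ₂) * (2 * DG * K₀) * ‖Ω‖ = DG * K₀ * (2 * ‖Ω‖ * (δ₁ + δ₂)) := by ring
    rw [heq]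
    exact h'
  -- (3) everything in terms of `‖Ω‖²` and `(δ₁+δ₂)²`
  have h3 : A₀ * ‖Ω‖ ^ 2 + 2 * (B₀ * ‖Ω‖ ^ 2 + (δ₁ + δ₂) * (2 * DG * K₀) * ‖Ω‖) ≤
      (A₀ + 2 * B₀ + 2 * DG * K₀) * ‖Ω‖ ^ 2 + 2 * DG * K₀ * (δ₁ + δ₂) ^ 2 := by
    have h := mul_le_mul_of_nonneg_left h2 (show (0 : ℝ) ≤ 2 by norm_num)
    linarith
  -- (4) `‖Ω‖² ≤ E_S / c₀`
  have h4 : (A₀ + 2 * B₀ + 2 * DG * K₀) * ‖Ω‖ ^ 2 ≤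
      (A₀ + 2 * B₀ + 2 * DG * K₀) * (⟪weightOp hS hδ₁ (U₁ t) Ω, Ω⟫ / c₀) :=
    mul_le_mul_of_nonneg_left hΩsq (by positivity)
  have h5 : (A₀ + 2 * B₀ + 2 * DG * K₀) * (⟪weightOp hS hδ₁ (U₁ t) Ω, Ω⟫ / c₀) +
      2 * DG * K₀ * (δ₁ + δ₂) ^ 2 ≤
      ((A₀ + 2 * B₀ + 2 * DG * K₀) / c₀ + 2 * DG * K₀) * (⟪weightOp hS hδ₁ (U₁ t) Ω, Ω⟫ + (δ₁ + δ₂) ^ 2) := by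
    have hc : (A₀ + 2 * B₀ + 2 * DG * K₀) * (⟪weightOp hS hδ₁ (U₁ t) Ω, Ω⟫ / c₀) =
        (A₀ + 2 * B₀ + 2 * DG * K₀) / c₀ * ⟪weightOp hS hδ₁ (U₁ t) Ω, Ω⟫ := by
      field_simp
    rw [hc]
    have hq1 : 0 ≤ (A₀ + 2 * B₀ + 2 * DG * K₀) / c₀ := div_nonneg (by positivity) hc₀.le
    have hq2 : 0 ≤ 2 * DG * K₀ := by positivity
    have e : ((A₀ + 2 * B₀ + 2 * DG * K₀) / c₀ + 2 * DG * K₀) * (⟪weightOp hS hδ₁ (U₁ t) Ω, Ω⟫ + (δ₁ + δ₂) ^ 2)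
        = ((A₀ + 2 * B₀ + 2 * DG * K₀) / c₀ * ⟪weightOp hS hδ₁ (U₁ t) Ω, Ω⟫ + 2 * DG * K₀ * (δ₁ + δ₂) ^ 2)
          + ((A₀ + 2 * B₀ + 2 * DG * K₀) / c₀ * (δ₁ + δ₂) ^ 2 + 2 * DG * K₀ * ⟪weightOp hS hδ₁ (U₁ t) Ω, Ω⟫) := by
      ring
    rw [e]
    exact le_add_of_nonneg_right (add_nonneg (mul_nonneg hq1 (sq_nonneg _)) (mul_nonneg hq2 hE0))
  have hfin := (h1.trans h3).trans ((add_le_add h4 le_rfl).trans h5)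
  rw [hA₀, hB₀, hDG, hDG₁, hClow, hMP] at hfin
  exact hfin

/-- **The initial difference**: `‖ρ_{δ₁} ⋆ u₀ - ρ_{δ₂} ⋆ u₀‖₂ ≤ (δ₁ + δ₂) Σⱼ ‖∂ⱼu₀‖₂`.
[cite: Adams1975, Lemma 2.18] -/
theorem norm_mollL2_dataL2_sub_le {δ₁ δ₂ : ℝ} (hδ₁ : 0 < δ₁) (hδ₂ : 0 < δ₂)
    (hu₀ : ContDiff ℝ ∞ u₀) (hu₀c : HasCompactSupport u₀) :
    ‖(mollL2 hδ₁ (dataL2 hu₀ hu₀c) - mollL2 hδ₂ (dataL2 hu₀ hu₀c) :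
      Lp (EuclideanSpace ℝ (Fin k)) 2 (volume : Measure (EuclideanSpace ℝ (Fin d))))‖ ≤
      (δ₁ + δ₂) * ∑ j, l2norm (cwd [j] u₀) := by
  set ρ₁ := moll (Fin d) hδ₁ with hρ₁
  set ρ₂ := moll (Fin d) hδ₂ with hρ₂
  have hu₀2 : MemLp u₀ 2 (volume : Measure (EuclideanSpace ℝ (Fin d))) := memLp_cwd_data hu₀ hu₀c []
  have hu₀j : ∀ j, MemLp (fun y => fderiv ℝ u₀ y (bv j)) 2 (volume : Measure (EuclideanSpace ℝ (Fin d))) :=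
    fun j => memLp_cwd_data hu₀ hu₀c [j]
  obtain ⟨hm1, hle1⟩ := l2norm_normed_convolution_sub_self_le (bump (Fin d) hδ₁)
    (hu₀.of_le (by exact_mod_cast le_top)) hu₀j
  obtain ⟨hm2, hle2⟩ := l2norm_normed_convolution_sub_self_le (bump (Fin d) hδ₂)
    (hu₀.of_le (by exact_mod_cast le_top)) hu₀j
  simp only [bump_rOut] at hle1 hle2
  change MemLp (fun x => (ρ₁ ⋆[lsmul ℝ ℝ, volume] u₀) x - u₀ x) 2 volume at hm1
  change l2norm (fun x => (ρ₁ ⋆[lsmul ℝ ℝ, volume] u₀) x - u₀ x) ≤ _ at hle1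
  change MemLp (fun x => (ρ₂ ⋆[lsmul ℝ ℝ, volume] u₀) x - u₀ x) 2 volume at hm2
  change l2norm (fun x => (ρ₂ ⋆[lsmul ℝ ℝ, volume] u₀) x - u₀ x) ≤ _ at hle2
  -- the representative of the difference
  have hae : ((mollL2 hδ₁ (dataL2 hu₀ hu₀c) - mollL2 hδ₂ (dataL2 hu₀ hu₀c) :
      Lp (EuclideanSpace ℝ (Fin k)) 2 (volume : Measure (EuclideanSpace ℝ (Fin d)))) :
        EuclideanSpace ℝ (Fin d) → EuclideanSpace ℝ (Fin k)) =ᵐ[volume]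
      (fun x => (ρ₁ ⋆[lsmul ℝ ℝ, volume] u₀) x - u₀ x) + fun x => -((ρ₂ ⋆[lsmul ℝ ℝ, volume] u₀) x - u₀ x) := by
    filter_upwards [coeFn_mollL2_sub hδ₁ hδ₂ (dataL2 hu₀ hu₀c) (dataL2 hu₀ hu₀c)] with x hx
    rw [hx, smoothRep_def, smoothRep_def, dataL2,
      convolution_kernel_congr_ae (ρ := ρ₁) (MemLp.coeFn_toLp (memLp_cwd_data hu₀ hu₀c [])),
      convolution_kernel_congr_ae (ρ := ρ₂) (MemLp.coeFn_toLp (memLp_cwd_data hu₀ hu₀c []))]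
    simp only [cwd_nil, Pi.add_apply]
    abel
  rw [Lp.norm_def, eLpNorm_congr_ae hae, ← l2norm_def]
  have hneg : MemLp (fun x => -((ρ₂ ⋆[lsmul ℝ ℝ, volume] u₀) x - u₀ x)) 2
      (volume : Measure (EuclideanSpace ℝ (Fin d))) := hm2.neg
  have hnegn : l2norm (fun x => -((ρ₂ ⋆[lsmul ℝ ℝ, volume] u₀) x - u₀ x)) =
      l2norm (fun x => (ρ₂ ⋆[lsmul ℝ ℝ, volume] u₀) x - u₀ x) := by
    have e : (fun x => -((ρ₂ ⋆[lsmul ℝ ℝ, volume] u₀) x - u₀ x)) =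
        -(fun x => (ρ₂ ⋆[lsmul ℝ ℝ, volume] u₀) x - u₀ x) := rfl
    rw [l2norm_def, l2norm_def, e, eLpNorm_neg]
  refine (l2norm_add_le hm1 hneg).trans ?_
  rw [hnegn]
  have hsum : ∑ j, l2norm (fun y => fderiv ℝ u₀ y (bv j)) = ∑ j, l2norm (cwd [j] u₀) := rfl
  rw [hsum] at hle1 hle2
  calc l2norm (fun x => (ρ₁ ⋆[lsmul ℝ ℝ, volume] u₀) x - u₀ x) +
        l2norm (fun x => (ρ₂ ⋆[lsmul ℝ ℝ, volume] u₀) x - u₀ x)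
      ≤ δ₁ * ∑ j, l2norm (cwd [j] u₀) + δ₂ * ∑ j, l2norm (cwd [j] u₀) := add_le_add hle1 hle2
    _ = (δ₁ + δ₂) * ∑ j, l2norm (cwd [j] u₀) := by ring

set_option maxHeartbeats 400000 in
/-- **The regularised flows are Cauchy in `L²`, uniformly on `[-T, T]`.** For smooth
symmetrizable tame coefficients and an order `m ≥ 4(d+1)` there are `C, γ ≥ 0` such that for
all `δ₁, δ₂ > 0`, every smooth compactly supported datum `u₀`, all solutions `U₁, U₂ : ℝ → L²`
of `Uᵢ' = F_{δᵢ}(Uᵢ)` with `Uᵢ(0) = u₀`, and every `T` on `[-T, T]` of which both energies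
`Σ_{|α| ≤ m} ‖Y^i_α‖²` stay `≤ 1` (cf. `exists_uniform_energy_bound`):
`‖ρ_{δ₁}⋆U₁(t) - ρ_{δ₂}⋆U₂(t)‖₂ ≤ C e^{γ|t|} (δ₁ + δ₂)(1 + Σⱼ‖∂ⱼu₀‖₂)` for all `|t| ≤ T`.
[cite: Majda1984, Ch. 2 §2.1, Thm 2.1 (proof, Step 2)]; [cite: TaylorPDEIII2011, Ch. 16 §1, (1.19)] -/
theorem exists_cauchy_bound (hS : IsSymmSmoothCoeff M L a b s) {m : ℕ} (hm : 4 * (d + 1) ≤ m) :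
    ∃ C γ : ℝ, 0 ≤ C ∧ 0 ≤ γ ∧ ∀ {δ₁ δ₂ : ℝ} (hδ₁ : 0 < δ₁) (hδ₂ : 0 < δ₂)
      (hu₀ : ContDiff ℝ ∞ u₀) (hu₀c : HasCompactSupport u₀)
      {U₁ U₂ : ℝ → Lp (EuclideanSpace ℝ (Fin k)) 2 (volume : Measure (EuclideanSpace ℝ (Fin d)))},
      U₁ 0 = dataL2 hu₀ hu₀c → U₂ 0 = dataL2 hu₀ hu₀c →
      (∀ t, HasDerivAt U₁ (regField hS.toIsTameCoeff hδ₁ (U₁ t)) t) →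
      (∀ t, HasDerivAt U₂ (regField hS.toIsTameCoeff hδ₂ (U₂ t)) t) →
      ∀ T : ℝ,
      (∀ t ∈ Icc (-T) T, ∑ α ∈ wordsLE (Fin d) m, ‖dcurve hS.toIsTameCoeff hδ₁ hu₀ hu₀c U₁ α t‖ ^ 2 ≤ 1) →
      (∀ t ∈ Icc (-T) T, ∑ α ∈ wordsLE (Fin d) m, ‖dcurve hS.toIsTameCoeff hδ₂ hu₀ hu₀c U₂ α t‖ ^ 2 ≤ 1) →
      ∀ t ∈ Icc (-T) T,
        l2norm (fun x => smoothRep (moll (Fin d) hδ₁) (U₁ t) x - smoothRep (moll (Fin d) hδ₂) (U₂ t) x) ≤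
          C * Real.exp (γ * |t|) * (δ₁ + δ₂) * (1 + ∑ j, l2norm (cwd [j] u₀)) := by
  -- orders
  set q : ℕ := m - 2 * (d + 1) with hqdef
  have hq : 1 ≤ q := by omega
  have hmq : m ≤ 2 * q := by omega
  have hqm : q + 2 * (d + 1) ≤ m := by omega
  have hm2 : 2 ≤ m := by omega
  have hmq' : m - 1 ≤ 2 * q + 1 := by omega
  -- coefficient constants
  obtain ⟨c₀, hc₀, hcoer⟩ := hS.coercive
  obtain ⟨K₀, hK₀0, hK₀⟩ := hS.exists_norm_s_le
  obtain ⟨K₁, hK₁0, hK₁⟩ := hS.exists_norm_fderiv_s_le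
  set R₀ : ℝ := Real.sqrt (supConst (Fin d) (EuclideanSpace ℝ (Fin k))) with hR₀def
  have hTa0 := fun j : Fin d =>
    exists_tame_bound_cwd_comp_whole (ι := Fin d) (m - 1) (hS.smooth_a j) (hS.bdd_a j) q hmq' R₀
  choose Ca hCa0 hCa using hTa0
  have hSa0 := fun j : Fin d =>
    exists_sup_bound_cwd_comp_whole (ι := Fin d) q (hS.smooth_a j) (hS.bdd_a j) R₀
  choose Ca' hCa'0 hCa' using hSa0
  obtain ⟨Cb, hCb0, hCb⟩ :=
    exists_tame_bound_cwd_comp_whole (ι := Fin d) (m - 1) hS.smooth_b hS.bdd_b q hmq' R₀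
  obtain ⟨Cs', hCs'0, hCs'⟩ := exists_sup_bound_cwd_comp_whole (ι := Fin d) q hS.smooth_s hS.bdd_s R₀
  set CA : ℝ := ∑ j, Ca j with hCA
  set CA' : ℝ := ∑ j, Ca' j with hCA'
  have hCA0 : 0 ≤ CA := Finset.sum_nonneg fun j _ => hCa0 j
  have hCA'0 : 0 ≤ CA' := Finset.sum_nonneg fun j _ => hCa'0 j
  have hleA : ∀ j, Ca j ≤ CA := fun j =>
    Finset.single_le_sum (f := Ca) (fun i _ => hCa0 i) (Finset.mem_univ j)
  have hleA' : ∀ j, Ca' j ≤ CA' := fun j =>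
    Finset.single_le_sum (f := Ca') (fun i _ => hCa'0 i) (Finset.mem_univ j)
  have hTa : ∀ (j : Fin d) (h : EuclideanSpace ℝ (Fin d) → EuclideanSpace ℝ (Fin k)), ContDiff ℝ ∞ h →
      (∀ c : List (Fin d), 1 ≤ c.length → c.length ≤ q → ∀ x, ‖cwd c h x‖ ≤ R₀) →
      ∀ Y : ℝ, 0 ≤ Y → (∀ c : List (Fin d), 1 ≤ c.length → c.length ≤ m - 1 →
        MemLp (cwd c h) 2 (volume : Measure (EuclideanSpace ℝ (Fin d))) ∧ l2norm (cwd c h) ≤ Y) →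
      ∀ v : List (Fin d), 1 ≤ v.length → v.length ≤ m - 1 →
        MemLp (cwd v (fun y => a j (h y))) 2 (volume : Measure (EuclideanSpace ℝ (Fin d))) ∧
          l2norm (cwd v (fun y => a j (h y))) ≤ CA * Y := by
    intro j h hh hsupc Y hY hL2c v hv1 hv
    obtain ⟨hm', hle'⟩ := hCa j h hh hsupc Y hY hL2c v hv1 hv
    exact ⟨hm', hle'.trans (mul_le_mul_of_nonneg_right (hleA j) hY)⟩
  have hSa : ∀ (j : Fin d) (h : EuclideanSpace ℝ (Fin d) → EuclideanSpace ℝ (Fin k)), ContDiff ℝ ∞ h →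
      (∀ c : List (Fin d), 1 ≤ c.length → c.length ≤ q → ∀ x, ‖cwd c h x‖ ≤ R₀) →
      ∀ v : List (Fin d), v.length ≤ q → ∀ x, ‖cwd v (fun y => a j (h y)) x‖ ≤ CA' :=
    fun j h hh hsupc v hv x => (hCa' j h hh hsupc v hv x).trans (hleA' j)
  -- the Grönwall rate and the final constant
  obtain ⟨Γ, hΓ⟩ : ∃ x : ℝ, x = (K₁ * ((d * M + L) * R₀) +
      2 * (d * ((K₀ * M + (Cs' * M + K₀ * CA')) / 2) + (d * M * R₀ + L) * K₀) +
      2 * (d * (d * M * 1 + (d * 2 ^ (m - 1) * (CA * R₀ + CA') + (Cb + L)))) * K₀) / c₀ +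
      2 * (d * (d * M * 1 + (d * 2 ^ (m - 1) * (CA * R₀ + CA') + (Cb + L)))) * K₀ := ⟨_, rfl⟩
  have hM0 : 0 ≤ M := hS.M_nonneg
  have hL0 : 0 ≤ L := hS.L_nonneg
  have hR₀0 : 0 ≤ R₀ := Real.sqrt_nonneg _
  have hd0 : (0 : ℝ) ≤ d := Nat.cast_nonneg d
  have hΓ0 : 0 ≤ Γ := by rw [hΓ]; positivity
  refine ⟨Real.sqrt ((K₀ + 1) / c₀), Γ, Real.sqrt_nonneg _, hΓ0, ?_⟩
  intro δ₁ δ₂ hδ₁ hδ₂ hu₀ hu₀c U₁ U₂ hU₁0 hU₂0 hU₁ hU₂ T hE₁ hE₂ t ht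
  -- the difference curve and its energy
  set Ω : ℝ → Lp (EuclideanSpace ℝ (Fin k)) 2 (volume : Measure (EuclideanSpace ℝ (Fin d))) :=
    fun τ => mollL2 hδ₁ (U₁ τ) - mollL2 hδ₂ (U₂ τ) with hΩdef
  set Φ : ℝ → ℝ := fun τ => ⟪weightOp hS hδ₁ (U₁ τ) (Ω τ), Ω τ⟫ + (δ₁ + δ₂) ^ 2 with hΦdef
  set Φ' : ℝ → ℝ := fun τ => ⟪weightOpDeriv hS hδ₁ (U₁ τ) (Ω τ), Ω τ⟫ +
    2 * ⟪weightOp hS hδ₁ (U₁ τ) (mollL2 hδ₁ (regField hS.toIsTameCoeff hδ₁ (U₁ τ)) -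
      mollL2 hδ₂ (regField hS.toIsTameCoeff hδ₂ (U₂ τ))), Ω τ⟫ with hΦ'def
  have hΩd : ∀ τ, HasDerivAt Ω (mollL2 hδ₁ (regField hS.toIsTameCoeff hδ₁ (U₁ τ)) -
      mollL2 hδ₂ (regField hS.toIsTameCoeff hδ₂ (U₂ τ))) τ := fun τ =>
    ((mollL2 hδ₁ : Lp (EuclideanSpace ℝ (Fin k)) 2 (volume : Measure (EuclideanSpace ℝ (Fin d))) →L[ℝ]
        _).hasFDerivAt.comp_hasDerivAt τ (hU₁ τ)).sub
      ((mollL2 hδ₂ : Lp (EuclideanSpace ℝ (Fin k)) 2 (volume : Measure (EuclideanSpace ℝ (Fin d))) →L[ℝ]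
        _).hasFDerivAt.comp_hasDerivAt τ (hU₂ τ))
  have hΦd : ∀ τ, HasDerivAt Φ (Φ' τ) τ := fun τ => by
    have h := (hasDerivAt_weighted_pair hS hδ₁ hU₁ (hΩd τ)).add_const ((δ₁ + δ₂) ^ 2)
    exact h
  have hΦ0 : ∀ τ, 0 ≤ Φ τ := fun τ =>
    add_nonneg (le_trans (mul_nonneg hc₀.le (sq_nonneg _)) (inner_weightOp_self_ge hS hδ₁ hcoer (U₁ τ) (Ω τ)))
      (sq_nonneg _)
  have hbd : ∀ τ ∈ Icc (-T) T, |Φ' τ| ≤ Γ * Φ τ := by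
    intro τ hτ
    have h := cauchy_deriv_bound_at hS hq hmq hqm hm2 hK₀ hK₁0 hK₁ le_rfl hCA0 hCA'0 hCb0 hCs'0 hc₀ hcoer
      hTa hSa hCb hCs' hδ₁ hδ₂ hu₀ hu₀c hU₁0 hU₂0 hU₁ hU₂ τ (hE₁ τ hτ) (hE₂ τ hτ) (Ω := Ω τ) rfl rfl
    rw [← hΓ] at h
    exact h
  have hG := gronwall_two_sided hΦ0 hΦd hbd t ht
  -- the initial value
  obtain ⟨D₀, hD₀⟩ : ∃ x : ℝ, x = ∑ j, l2norm (cwd [j] u₀) := ⟨_, rfl⟩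
  have hD₀0 : 0 ≤ D₀ := by rw [hD₀]; exact Finset.sum_nonneg fun j _ => l2norm_nonneg _
  have hΩ0 : ‖Ω 0‖ ≤ (δ₁ + δ₂) * D₀ := by
    have h := norm_mollL2_dataL2_sub_le (k := k) hδ₁ hδ₂ hu₀ hu₀c
    have e : Ω 0 = mollL2 hδ₁ (dataL2 hu₀ hu₀c) - mollL2 hδ₂ (dataL2 hu₀ hu₀c) := by
      simp only [hΩdef, hU₁0, hU₂0]
    rw [e, hD₀]
    exact h
  have hΦinit : Φ 0 ≤ (K₀ + 1) * (1 + D₀) ^ 2 * (δ₁ + δ₂) ^ 2 := by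
    have h1 : ⟪weightOp hS hδ₁ (U₁ 0) (Ω 0), Ω 0⟫ ≤ K₀ * ‖Ω 0‖ ^ 2 :=
      inner_weightOp_self_le hS hδ₁ hK₀ (U₁ 0) (Ω 0)
    have h2 : ‖Ω 0‖ ^ 2 ≤ ((δ₁ + δ₂) * D₀) ^ 2 := pow_le_pow_left₀ (norm_nonneg _) hΩ0 2
    have h3 : ⟪weightOp hS hδ₁ (U₁ 0) (Ω 0), Ω 0⟫ ≤ K₀ * ((δ₁ + δ₂) * D₀) ^ 2 :=
      h1.trans (mul_le_mul_of_nonneg_left h2 hK₀0)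
    have h4 : K₀ * D₀ ^ 2 + 1 ≤ (K₀ + 1) * (1 + D₀) ^ 2 := by nlinarith
    have h5 : (K₀ * D₀ ^ 2 + 1) * (δ₁ + δ₂) ^ 2 ≤ (K₀ + 1) * (1 + D₀) ^ 2 * (δ₁ + δ₂) ^ 2 :=
      mul_le_mul_of_nonneg_right h4 (sq_nonneg _)
    change ⟪weightOp hS hδ₁ (U₁ 0) (Ω 0), Ω 0⟫ + (δ₁ + δ₂) ^ 2 ≤ _
    have e : K₀ * ((δ₁ + δ₂) * D₀) ^ 2 + (δ₁ + δ₂) ^ 2 = (K₀ * D₀ ^ 2 + 1) * (δ₁ + δ₂) ^ 2 := by ring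
    linarith
  -- from the energy to the norm
  have hΩsq : ‖Ω t‖ ^ 2 ≤ Φ t / c₀ := by
    rw [le_div_iff₀ hc₀, mul_comm]
    change c₀ * ‖Ω t‖ ^ 2 ≤ ⟪weightOp hS hδ₁ (U₁ t) (Ω t), Ω t⟫ + (δ₁ + δ₂) ^ 2
    exact (inner_weightOp_self_ge hS hδ₁ hcoer (U₁ t) (Ω t)).trans (le_add_of_nonneg_right (sq_nonneg _))
  have hexp : Real.exp (Γ * |t|) ≤ Real.exp (Γ * |t|) ^ 2 := by
    have h1 : 1 ≤ Real.exp (Γ * |t|) := Real.one_le_exp (mul_nonneg hΓ0 (abs_nonneg t))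
    nlinarith
  set B : ℝ := Real.sqrt ((K₀ + 1) / c₀) * Real.exp (Γ * |t|) * (δ₁ + δ₂) * (1 + D₀) with hB
  have hB0 : 0 ≤ B := by positivity
  have hBsq : B ^ 2 = (K₀ + 1) / c₀ * Real.exp (Γ * |t|) ^ 2 * (δ₁ + δ₂) ^ 2 * (1 + D₀) ^ 2 := by
    rw [hB, mul_pow, mul_pow, mul_pow, Real.sq_sqrt (div_nonneg (by positivity) hc₀.le)]
  have hsq : ‖Ω t‖ ^ 2 ≤ B ^ 2 := by
    rw [hBsq]
    calc ‖Ω t‖ ^ 2 ≤ Φ t / c₀ := hΩsq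
      _ ≤ Real.exp (Γ * |t|) * Φ 0 / c₀ := div_le_div_of_nonneg_right hG hc₀.le
      _ ≤ Real.exp (Γ * |t|) ^ 2 * ((K₀ + 1) * (1 + D₀) ^ 2 * (δ₁ + δ₂) ^ 2) / c₀ := by
          refine div_le_div_of_nonneg_right ?_ hc₀.le
          exact mul_le_mul hexp hΦinit (hΦ0 0) (sq_nonneg _)
      _ = (K₀ + 1) / c₀ * Real.exp (Γ * |t|) ^ 2 * (δ₁ + δ₂) ^ 2 * (1 + D₀) ^ 2 := by
          field_simp
  have hfin : ‖Ω t‖ ≤ B := by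
    have h := Real.sqrt_le_sqrt hsq
    rwa [Real.sqrt_sq (norm_nonneg _), Real.sqrt_sq hB0] at h
  -- the representative
  have hΩn : ‖Ω t‖ = l2norm (fun x => smoothRep (moll (Fin d) hδ₁) (U₁ t) x -
      smoothRep (moll (Fin d) hδ₂) (U₂ t) x) := by
    rw [Lp.norm_def, l2norm_def, eLpNorm_congr_ae (coeFn_mollL2_sub hδ₁ hδ₂ (U₁ t) (U₂ t))]
  rw [← hΩn, ← hD₀]
  exact hfin

end Literature.Barriers.AtomisticToContinuum

end
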